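import Literature.AlgebraicGeometry.Motives.FamiliesVHSComap
import Literature.NumberTheory.Transcendental.AnalytificationConnected
import Mathlib.AlgebraicGeometry.Morphisms.UniversallyClosed
import HarnessLib

/-!
# Zariski-closed sets of complex points: preimages, images under universally closed morphisms, and DESCENT
# along a finite (universally closed) surjective morphism — the scheme side of «one is free to replace `S` by a
# finite etale covering `S' → S`» (Cattani–Deligne–Kaplan)

Topic `Literature/AlgebraicGeometry/Motives` (namespaces `Literature.AlgebraicGeometry.Motives`,
`….Motives.ComplexPoints`, `….Motives.VHSData`), lane `lit-hodgefound` (seat `p08`, row g56-#2).  THEOREMS ONLY (no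
definition, no named fact, no instance; D-0026 net debt `0`).

The tree phrases «the Hodge locus is algebraic» (Cattani–Deligne–Kaplan 1995, Cor. 1.2) through
`IsZariskiClosedOnPoints T A` (`Motives/FamiliesVHS`): a set `A ⊆ T(L)` of `L`-points of a `k`-scheme `T` is `Z(L)` for
a Zariski-closed `Z ⊆ T`.  This file supplies the functoriality of that notion which the first line of CDK's proof of
Thm. 1.1 uses — E. Cattani, P. Deligne, A. Kaplan, *On the locus of Hodge classes*, J. Amer. Math. Soc. 8 (1995), «Proof
of 1.5 ⟹ 1.1» (p. 485; held text `paper:arxiv-alg-geom_9402009` p0002), VERBATIM: «To prove 1.1 one is free to replace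
`S` of 1.1 by a finite etale covering `S' → S`.» — namely that Zariski closedness of a set of complex points may be
checked after pulling back along a finite surjective morphism:

* §1 `IsZariskiClosedOnPoints.preimage_map` — for ANY morphism `g : T' ⟶ T` of `k`-schemes, `g(L)⁻¹(Z(L)) = (g⁻¹Z)(L)`:
  preimages of sets Zariski closed on points are Zariski closed on points.
* §2 `ComplexPoints.exists_map_eq_of_pt_mem_image_of_isClosed` — over `ℂ`, `S'` and `S` locally of finite type: a
  complex point `P` of `S` whose underlying point lies in `g(Z')`, `Z' ⊆ S'` closed, is `g(Q)` for a complex point `Q` of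
  `S'` lying in `Z'` (the fibre `g⁻¹(P) ∩ Z'` is a non-empty closed subset of the Jacobson space `S'`, so it has a closed
  point, i.e. a complex point by the Nullstellensatz — the tree's `ComplexPoints.equivClosedPoints`).
* §3 `IsZariskiClosedOnPoints.image_map` — for `g : S' ⟶ S` UNIVERSALLY CLOSED (e.g. finite, proper; Mathlib
  `Scheme.Hom.isClosedMap`) between `ℂ`-schemes locally of finite type, `g(ℂ)(Z'(ℂ)) = (g Z')(ℂ)`: images of sets Zariski
  closed on points are Zariski closed on points; hence DESCENT `IsZariskiClosedOnPoints.of_preimage_map` along such a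
  `g` that is surjective on complex points, and `isZariskiClosedOnPoints_iff_preimage_map`.
* §4 `VHSData.isZariskiClosedOnPoints_hodgeLocusOfNormLe_iff_comap` — for the data `D : VHSData S(ℂ) n` of a polarized
  `ℤ`VHS on the complex points of `S` and its pull-back `g(ℂ)* D = D.comap g(ℂ)` (`Motives/FamiliesVHSComap`:
  `Hdg-locus_{≤ K}(g(ℂ)* D) = g(ℂ)⁻¹ Hdg-locus_{≤ K}(D)`): **the Hodge locus of norm `≤ K` of `D` is Zariski closed on
  points of `S` iff that of `g(ℂ)* D` is Zariski closed on points of `S'`** — CDK's reduction of Thm. 1.1 / Cor. 1.2 to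
  a finite étale cover, in the vocabulary of the tree's barrier `Barriers/HodgeConjecture/HodgeLocusAlgebraic`.

HONEST SCOPE.  Étaleness of `g` plays no role in the descent (it is needed in CDK only to keep `g* 𝒱` a variation on a
SMOOTH `S'` and, through the monodromy `mod k ≥ 3`, to make the local monodromy at infinity unipotent — not here);
surjectivity of `g(ℂ)` is a hypothesis (for `g` surjective on scheme points it is the tree's
`AlgPoints.map_surjective_of_surjective`, `Motives/JacobianHomology`).  Nothing here is specific to Hodge theory
except §4, which is bookkeeping over `hodgeLocusOfNormLe_comap`.

## References

* [CattaniDeligneKaplan1995] E. Cattani, P. Deligne, A. Kaplan, *On the locus of Hodge classes*, J. Amer. Math. Soc. 8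
  (1995) 483–506: Thm. 1.1, Cor. 1.2 (p. 484), «Proof of 1.5 ⟹ 1.1» (p. 485).
* [Hartshorne1977] R. Hartshorne, *Algebraic Geometry* (1977), Ch. II §3 (morphisms of finite type, Ex. 3.14: closed
  points of schemes of finite type over a field), Ch. II §4 (Ex. 4.1: a finite morphism is proper; Cor. 4.8).
* [MumfordRedBook1999] D. Mumford, *The Red Book of Varieties and Schemes* (2nd ed. 1999), Ch. I §10 (complex points
  and closed points: the Nullstellensatz), Ch. II §4, Ch. II §7 (proper and finite morphisms are closed).
-/

noncomputable section

open CategoryTheory AlgebraicGeometry Set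

universe u

namespace Literature.AlgebraicGeometry.Motives

/-! ## §1 Preimages of Zariski-closed sets of points -/

section Preimage

variable {k : Type u} [Field k] {L : Type u} [Field L] [Algebra k L] {T' T : SchemeOver k}

/-- **Preimages of sets Zariski closed on points are Zariski closed on points**: for a morphism of `k`-schemes
`g : T' ⟶ T` and `A = Z(L)` with `Z ⊆ T` closed, `g(L)⁻¹(A) = (g⁻¹ Z)(L)` with `g⁻¹ Z` closed (continuity of `g`; the
underlying point of `g(L)(P')` is `g(pt P')`). [cite: Hartshorne1977, Ch. II §3] [cite: MumfordRedBook1999, Ch. II §4] -/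
theorem IsZariskiClosedOnPoints.preimage_map (g : T' ⟶ T) {A : Set (AlgPoints T L)} (hA : IsZariskiClosedOnPoints T A) :
    IsZariskiClosedOnPoints T' (AlgPoints.map g ⁻¹' A) := by
  obtain ⟨Z, hZ, rfl⟩ := hA
  refine ⟨g.left ⁻¹' Z, hZ.preimage g.left.continuous, Set.ext fun P' => ?_⟩
  simp only [mem_preimage, mem_setOf_eq, AlgPoints.pt_map]

/-- Pointwise form: under `A = Z(L)`, `g(L)(P') ∈ A ↔ g(pt P') ∈ Z`. [cite: Hartshorne1977, Ch. II §3] -/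
theorem IsZariskiClosedOnPoints.map_mem_iff (g : T' ⟶ T) {A : Set (AlgPoints T L)} {Z : Set T.left}
    (hAZ : A = {P | P.pt ∈ Z}) (P' : AlgPoints T' L) : AlgPoints.map g P' ∈ A ↔ g.left P'.pt ∈ Z := by
  subst hAZ
  simp only [mem_setOf_eq, AlgPoints.pt_map]

end Preimage

/-! ## §2 Complex points over the image of a closed set lift into the closed set -/

namespace ComplexPoints

variable {S' S : SchemeOver ℂ} (g : S' ⟶ S)

/-- **Complex points over the image of a closed set lift into it.**  For a morphism `g : S' ⟶ S` of `ℂ`-schemes locally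
of finite type, a closed `Z' ⊆ S'` and a complex point `P` of `S` with `pt P ∈ g(Z')`, there is a complex point `Q` of
`S'` with `pt Q ∈ Z'` and `g(Q) = P`: the set `g⁻¹(pt P) ∩ Z'` is closed (complex points are closed points) and
non-empty, so — `S'` being a Jacobson space — it contains a closed point, which is (the underlying point of) a complex
point by Hilbert's Nullstellensatz; and a complex point of `S` is determined by its underlying point.
[cite: MumfordRedBook1999, Ch. I §10] [cite: Hartshorne1977, Ch. II §3 Ex. 3.14] -/
theorem exists_map_eq_of_pt_mem_image_of_isClosed [LocallyOfFiniteType S'.hom] [LocallyOfFiniteType S.hom]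
    {Z' : Set S'.left} (hZ' : IsClosed Z') (P : ComplexPoints S) (hP : P.pt ∈ g.left '' Z') :
    ∃ Q : ComplexPoints S', Q.pt ∈ Z' ∧ AlgPoints.map g Q = P := by
  haveI : JacobsonSpace ↥S'.left := LocallyOfFiniteType.jacobsonSpace S'.hom
  have hcl : IsClosed (g.left ⁻¹' ({P.pt} : Set S.left) ∩ Z') :=
    ((ComplexPoints.isClosed_pt P).preimage g.left.continuous).inter hZ'
  obtain ⟨x, hxZ', hx⟩ := hP
  have hne : (g.left ⁻¹' ({P.pt} : Set S.left) ∩ Z').Nonempty := ⟨x, hx, hxZ'⟩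
  obtain ⟨q, ⟨hq, hqZ'⟩, hqc⟩ := nonempty_inter_closedPoints hne hcl.isLocallyClosed
  refine ⟨(equivClosedPoints S').symm ⟨q, hqc⟩, ?_, ?_⟩
  · rw [pt_equivClosedPoints_symm_apply]
    exact hqZ'
  · apply (equivClosedPoints S).injective
    apply Subtype.ext
    rw [coe_equivClosedPoints_apply, coe_equivClosedPoints_apply, AlgPoints.pt_map, pt_equivClosedPoints_symm_apply]
    exact hq

end ComplexPoints

/-! ## §3 Images under universally closed morphisms; descent along finite surjective morphisms -/

section Image

variable {S' S : SchemeOver ℂ} (g : S' ⟶ S)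

/-- **Images of sets Zariski closed on points under a universally closed morphism are Zariski closed on points.**  For
`g : S' ⟶ S` universally closed (e.g. finite, proper) between `ℂ`-schemes locally of finite type and `A' = Z'(ℂ)` with
`Z' ⊆ S'` closed: `g(ℂ)(A') = (g Z')(ℂ)`, and `g Z'` is closed («a proper morphism is closed»; the inclusion `⊇` is the
lifting of complex points over `g(Z')` into `Z'`). [cite: Hartshorne1977, Ch. II §4 Ex. 4.1 and Cor. 4.8]
[cite: MumfordRedBook1999, Ch. I §10 and Ch. II §7] -/
theorem IsZariskiClosedOnPoints.image_map [LocallyOfFiniteType S'.hom] [LocallyOfFiniteType S.hom]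
    [UniversallyClosed g.left] {A' : Set (ComplexPoints S')} (hA' : IsZariskiClosedOnPoints S' A') :
    IsZariskiClosedOnPoints S (AlgPoints.map g '' A') := by
  obtain ⟨Z', hZ', rfl⟩ := hA'
  refine ⟨g.left '' Z', g.left.isClosedMap _ hZ', Set.ext fun P => ⟨?_, fun hP => ?_⟩⟩
  · rintro ⟨Q, hQ, rfl⟩
    exact ⟨Q.pt, hQ, (AlgPoints.pt_map g Q).symm⟩
  · obtain ⟨Q, hQZ', hQP⟩ := ComplexPoints.exists_map_eq_of_pt_mem_image_of_isClosed g hZ' P hP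
    exact ⟨Q, hQZ', hQP⟩

/-- **Descent of Zariski closedness on points along a universally closed morphism surjective on complex points** («one
is free to replace `S` by a finite etale covering `S' → S`»): if `g(ℂ)⁻¹(A)` is Zariski closed on points of `S'`, then
`A = g(ℂ)(g(ℂ)⁻¹ A)` is Zariski closed on points of `S`. [cite: CattaniDeligneKaplan1995, «Proof of 1.5 ⟹ 1.1» (p. 485)]
[cite: Hartshorne1977, Ch. II §4 Ex. 4.1 and Cor. 4.8] -/
theorem IsZariskiClosedOnPoints.of_preimage_map [LocallyOfFiniteType S'.hom] [LocallyOfFiniteType S.hom]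
    [UniversallyClosed g.left] (hsurj : Function.Surjective (AlgPoints.map (L := ℂ) g)) {A : Set (ComplexPoints S)}
    (hA : IsZariskiClosedOnPoints S' (AlgPoints.map g ⁻¹' A)) : IsZariskiClosedOnPoints S A := by
  rw [← image_preimage_eq A hsurj]
  exact hA.image_map g

/-- **Zariski closedness on points is checked after a finite surjective base change**: for `g : S' ⟶ S` universally
closed and surjective on complex points (`ℂ`-schemes locally of finite type), `A ⊆ S(ℂ)` is Zariski closed on points
iff `g(ℂ)⁻¹(A) ⊆ S'(ℂ)` is. [cite: CattaniDeligneKaplan1995, «Proof of 1.5 ⟹ 1.1» (p. 485)]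
[cite: Hartshorne1977, Ch. II §4 Ex. 4.1 and Cor. 4.8] -/
theorem isZariskiClosedOnPoints_iff_preimage_map [LocallyOfFiniteType S'.hom] [LocallyOfFiniteType S.hom]
    [UniversallyClosed g.left] (hsurj : Function.Surjective (AlgPoints.map (L := ℂ) g)) (A : Set (ComplexPoints S)) :
    IsZariskiClosedOnPoints S A ↔ IsZariskiClosedOnPoints S' (AlgPoints.map g ⁻¹' A) :=
  ⟨fun h => h.preimage_map g, fun h => h.of_preimage_map g hsurj⟩

/-- Surjectivity of `g(ℂ)` from surjectivity of `g` on scheme points (`ℂ`-schemes locally of finite type), in the form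
consumed by `IsZariskiClosedOnPoints.of_preimage_map`: every complex point of `S` lies under `g(S') = S` (the tree's
`AlgPoints.map_surjective_of_surjective`, `AlgPoints.exists_map_eq_of_pt_mem_range`; here read off §2 with `Z' = S'`).
[cite: MumfordRedBook1999, Ch. I §10] [cite: Hartshorne1977, Ch. II §4 Ex. 4.1 and Cor. 4.8] -/
theorem IsZariskiClosedOnPoints.of_preimage_map_of_range_eq_univ [LocallyOfFiniteType S'.hom]
    [LocallyOfFiniteType S.hom] [UniversallyClosed g.left] (hrange : range g.left = univ) {A : Set (ComplexPoints S)}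
    (hA : IsZariskiClosedOnPoints S' (AlgPoints.map g ⁻¹' A)) : IsZariskiClosedOnPoints S A :=
  hA.of_preimage_map g fun P => by
    obtain ⟨Q, -, hQ⟩ := ComplexPoints.exists_map_eq_of_pt_mem_image_of_isClosed g isClosed_univ P
      (by rw [image_univ, hrange]; exact mem_univ _)
    exact ⟨Q, hQ⟩

end Image

/-! ## §4 The Hodge locus of bounded norm: Zariski closedness is checked on a finite surjective cover -/

namespace VHSData

variable {S' S : SchemeOver ℂ} (g : S' ⟶ S) {n : ℤ} (D : VHSData (ComplexPoints S) n)

/-- The Hodge locus of norm `≤ K` of the pull-back `g(ℂ)* D` is the preimage under `g(ℂ)` of that of `D`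
(`hodgeLocusOfNormLe_comap` for the continuous map `g(ℂ) = AlgPoints.mapContinuous g`). [cite: CattaniDeligneKaplan1995, «Proof of 1.5 ⟹ 1.1» (p. 485)] -/
theorem hodgeLocusOfNormLe_comap_mapContinuous (p K : ℤ) :
    (D.comap (AlgPoints.mapContinuous (L := ℂ) g)).hodgeLocusOfNormLe p K = AlgPoints.map g ⁻¹' D.hodgeLocusOfNormLe p K :=
  D.hodgeLocusOfNormLe_comap _ p K

/-- **Pull-back**: if the Hodge locus of norm `≤ K` of `D` is Zariski closed on points of `S`, that of `g(ℂ)* D` is Zariski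
closed on points of `S'` (any `g`). [cite: CattaniDeligneKaplan1995, Thm. 1.1 and «Proof of 1.5 ⟹ 1.1» (p. 485)] -/
theorem isZariskiClosedOnPoints_hodgeLocusOfNormLe_comap {p K : ℤ}
    (h : IsZariskiClosedOnPoints S (D.hodgeLocusOfNormLe p K)) :
    IsZariskiClosedOnPoints S' ((D.comap (AlgPoints.mapContinuous (L := ℂ) g)).hodgeLocusOfNormLe p K) := by
  rw [hodgeLocusOfNormLe_comap_mapContinuous]
  exact h.preimage_map g

/-- **DESCENT — «one is free to replace `S` of 1.1 by a finite etale covering `S' → S`»**: for `g : S' ⟶ S` universally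
closed (finite, proper) and surjective on complex points, `S'`, `S` locally of finite type over `ℂ`, if the Hodge locus
of norm `≤ K` of the pulled-back datum `g(ℂ)* D` is Zariski closed on points of `S'` (Thm. 1.1 / Cor. 1.2 for `g* 𝒱`),
then the Hodge locus of norm `≤ K` of `D` is Zariski closed on points of `S` (Thm. 1.1 / Cor. 1.2 for `𝒱`).
[cite: CattaniDeligneKaplan1995, Thm. 1.1, Cor. 1.2 (p. 484) and «Proof of 1.5 ⟹ 1.1» (p. 485)] -/
theorem isZariskiClosedOnPoints_hodgeLocusOfNormLe_of_comap [LocallyOfFiniteType S'.hom] [LocallyOfFiniteType S.hom]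
    [UniversallyClosed g.left] (hsurj : Function.Surjective (AlgPoints.map (L := ℂ) g)) {p K : ℤ}
    (h : IsZariskiClosedOnPoints S' ((D.comap (AlgPoints.mapContinuous (L := ℂ) g)).hodgeLocusOfNormLe p K)) :
    IsZariskiClosedOnPoints S (D.hodgeLocusOfNormLe p K) := by
  rw [hodgeLocusOfNormLe_comap_mapContinuous] at h
  exact h.of_preimage_map g hsurj

/-- **The Hodge locus of bounded norm is algebraic iff it is so after a finite surjective base change**: for `g : S' ⟶ S`
universally closed and surjective on complex points (`ℂ`-schemes locally of finite type), the Hodge locus of norm `≤ K`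
of `D` is Zariski closed on points of `S` iff that of `g(ℂ)* D` is Zariski closed on points of `S'`.
[cite: CattaniDeligneKaplan1995, Thm. 1.1, Cor. 1.2 (p. 484) and «Proof of 1.5 ⟹ 1.1» (p. 485)] -/
theorem isZariskiClosedOnPoints_hodgeLocusOfNormLe_iff_comap [LocallyOfFiniteType S'.hom] [LocallyOfFiniteType S.hom]
    [UniversallyClosed g.left] (hsurj : Function.Surjective (AlgPoints.map (L := ℂ) g)) (p K : ℤ) :
    IsZariskiClosedOnPoints S (D.hodgeLocusOfNormLe p K) ↔
      IsZariskiClosedOnPoints S' ((D.comap (AlgPoints.mapContinuous (L := ℂ) g)).hodgeLocusOfNormLe p K) :=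
  ⟨fun h => D.isZariskiClosedOnPoints_hodgeLocusOfNormLe_comap g h,
    fun h => D.isZariskiClosedOnPoints_hodgeLocusOfNormLe_of_comap g hsurj h⟩

end VHSData

end Literature.AlgebraicGeometry.Motives

end
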